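import Mathlib
import HarnessLib
import Summits.NavierStokesRegularity.NavierStokesRegularity.Theorems.PoloidalWindowRigidity.Negative.TriSheetField
import Summits.NavierStokesRegularity.NavierStokesRegularity.Theorems.PoloidalWindowRigidity.Negative.TriWaveProfile
import Literature.Algebra.EuclideanLattices.FccBccLattices

/-!
# Crux `PoloidalWindowRigidity` (K2, stmt-NavierStokesRegularity-19708) — negative side:
# the THREE-SHEET poloidal frozen Type-I profile

Negative-side support (refuter seat ns-regularity-refuter1 gen 2, cell ns-regularity-ideate; D-0081 §C).

The Type-I profile WITH LOGARITHMIC DRIFT built on the three-sheet field `S` of `…Negative.TriSheetField`: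
`v(t,x) = (−t)^{-1/2} S((−t)^{-1/2} x + log(−t) e₁)` (`sheetProfile`).  As for the three-wave profile
(`…Negative.TriWaveProfile`): rate `‖v(t)‖ ≤ 6(−t)^{-1/2}`, continuity on the slab, the scale-sharp ClassRates
`‖Dv(t)‖ ≤ 24/(−t)`, `‖curl v(t)‖ ≤ 12/(−t)`, divergence-free, poloidal, frozen, backward-singular at the apex (on
the moving slab `3√τ/10 < x₀ + x₂ < 7√τ/20` of the cylinder `(−τ,−τ/2) × B(0,√τ)` the similarity coordinate
`u = (−t)^{-1/2}(x₀+x₂)` lies in `[3/10, 1/2]`, where `β ≥ 1/6`, so `‖v‖ ≥ (−t)^{-1/2}/6`), and clause (vii) of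
the residue stub S2⁗ «super-critical production near every vorticity record» holds NON-VACUOUSLY: `(−s)²|ω|²` is
the bounded function `|curl S|² ≤ 80` of the similarity variable and at the record `(s,y) = (−1, 0)` one has
`|ω|² = 80 < 128 = (−s)⟪ω, Dv ω⟫` (the same numbers as for the three-wave field).  The point of the replacement:
every slice of `v` has energy `O(R²)` in balls of radius `R` (sequel `…TriSheetEnergy`), the large-scale rate of
the mild class.  WHAT THIS IS NOT: not a claim about Navier–Stokes — kinematics of an explicit profile; the crux K2
stays open. [folklore]
-/

noncomputable section

-- the summit and its single sub-problem share the name (CONVENTIONS §1), as in every Theorems file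
set_option linter.dupNamespace false

namespace Summit.NavierStokesRegularity.NavierStokesRegularity.Theorems.PoloidalWindowRigidity.Negative

open MeasureTheory Set Function Filter Topology Metric
open scoped RealInnerProductSpace InnerProductSpace ENNReal NNReal
open Literature.Analysis Literature.Analysis.FluidPDE

/-! ## The three-sheet Type-I profile with logarithmic drift -/

/-- The three-sheet Type-I profile `v(t,x) = (−t)^{-1/2} S((−t)^{-1/2} x + log(−t) e₁)`. [folklore] -/
def sheetProfile (t : ℝ) (x : EuclideanSpace ℝ (Fin 3)) : EuclideanSpace ℝ (Fin 3) :=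
  cellAmp t • sheetField (driftShift t x)

/-- On the slice `t = −1` the profile is the three-sheet field. [folklore] -/
theorem sheetProfile_neg_one : sheetProfile (-1) = sheetField := by
  funext x
  simp only [sheetProfile, driftShift_neg_one, cellAmp_neg_one, one_smul]

/-- `Dv(t)(x) = (−t)^{-1/2} DS(A_t x) ∘ DA_t`. [folklore] -/
theorem hasFDerivAt_sheetProfile (t : ℝ) (x : EuclideanSpace ℝ (Fin 3)) :
    HasFDerivAt (sheetProfile t)
      (cellAmp t • ((sheetDeriv (driftShift t x)).comp
        (cellAmp t • ContinuousLinearMap.id ℝ (EuclideanSpace ℝ (Fin 3))))) x := by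
  show HasFDerivAt (fun x => cellAmp t • sheetField (driftShift t x)) _ x
  exact ((hasFDerivAt_sheetField (driftShift t x)).comp x (hasFDerivAt_driftShift t x)).const_smul (cellAmp t)

/-- `Dv(t)(x) w` in coordinates: `(−t)^{-1} (DS(A_t x) w)ᵢ`. [folklore] -/
theorem fderiv_sheetProfile_apply (t : ℝ) (x w : EuclideanSpace ℝ (Fin 3)) (i : Fin 3) :
    fderiv ℝ (sheetProfile t) x w i = cellAmp t ^ 2 * sheetDeriv (driftShift t x) w i := by
  rw [(hasFDerivAt_sheetProfile t x).fderiv]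
  simp [sq, mul_assoc]

/-- `Dv(t)(x) = (−t)^{-1} DS(A_t x)` as continuous linear maps. [folklore] -/
theorem fderiv_sheetProfile (t : ℝ) (x : EuclideanSpace ℝ (Fin 3)) :
    fderiv ℝ (sheetProfile t) x = (cellAmp t ^ 2) • sheetDeriv (driftShift t x) := by
  ext w i
  rw [fderiv_sheetProfile_apply]
  simp

/-- **The scale-sharp gradient rate**: `‖Dv(t)(x)‖ ≤ 24/(−t)`. [folklore] -/
theorem norm_fderiv_sheetProfile_le {t : ℝ} (ht : t < 0) (x : EuclideanSpace ℝ (Fin 3)) :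
    ‖fderiv ℝ (sheetProfile t) x‖ ≤ 24 / (-t) := by
  rw [fderiv_sheetProfile, norm_smul, Real.norm_of_nonneg (sq_nonneg _), cellAmp_sq ht, div_eq_inv_mul]
  refine mul_le_mul_of_nonneg_left ?_ (inv_nonneg.2 (by linarith))
  exact ContinuousLinearMap.opNorm_le_bound _ (by norm_num) (norm_sheetDeriv_apply_le _)

/-- `curl v(t) = (−t)^{-1} (curl S)(A_t x)`, in coordinates. [folklore] -/
theorem curl_sheetProfile (t : ℝ) (x : EuclideanSpace ℝ (Fin 3)) : curl (sheetProfile t) x =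
    (cellAmp t ^ 2 * (2 * oddBumpDeriv (driftShift t x 1 - driftShift t x 2) +
        2 * oddBumpDeriv (driftShift t x 1 + driftShift t x 2))) • (EuclideanSpace.single (0 : Fin 3) (1 : ℝ)) +
      (cellAmp t ^ 2 * (2 * oddBumpDeriv (driftShift t x 0 + driftShift t x 2))) •
        (EuclideanSpace.single (1 : Fin 3) (1 : ℝ)) := by
  ext i
  fin_cases i <;>
    simp [curl, fderiv_sheetProfile, sheetDeriv_apply_zero, sheetDeriv_apply_one, sheetDeriv_apply_two] <;> ring

/-- The first component of `curl v(t)(x)`. [folklore] -/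
theorem curl_sheetProfile_apply_zero (t : ℝ) (x : EuclideanSpace ℝ (Fin 3)) : curl (sheetProfile t) x 0 =
    cellAmp t ^ 2 * (2 * oddBumpDeriv (driftShift t x 1 - driftShift t x 2) +
      2 * oddBumpDeriv (driftShift t x 1 + driftShift t x 2)) := by
  rw [curl_sheetProfile]; simp

/-- The second component of `curl v(t)(x)`. [folklore] -/
theorem curl_sheetProfile_apply_one (t : ℝ) (x : EuclideanSpace ℝ (Fin 3)) :
    curl (sheetProfile t) x 1 = cellAmp t ^ 2 * (2 * oddBumpDeriv (driftShift t x 0 + driftShift t x 2)) := by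
  rw [curl_sheetProfile]; simp

/-- The third component of `curl v(t)(x)` vanishes. [folklore] -/
theorem curl_sheetProfile_apply_two (t : ℝ) (x : EuclideanSpace ℝ (Fin 3)) : curl (sheetProfile t) x 2 = 0 := by
  rw [curl_sheetProfile]; simp

/-- **The vorticity rate**: `‖curl v(t)(x)‖ ≤ 12/(−t)`. [folklore] -/
theorem norm_curl_sheetProfile_le {t : ℝ} (ht : t < 0) (x : EuclideanSpace ℝ (Fin 3)) :
    ‖curl (sheetProfile t) x‖ ≤ 12 / (-t) := by
  have e0 : ‖(EuclideanSpace.single (0 : Fin 3) (1 : ℝ) : EuclideanSpace ℝ (Fin 3))‖ = 1 := by simp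
  have e1 : ‖(EuclideanSpace.single (1 : Fin 3) (1 : ℝ) : EuclideanSpace ℝ (Fin 3))‖ = 1 := by simp
  have hsq := cellAmp_sq ht
  have hpos : 0 < (-t)⁻¹ := inv_pos.2 (by linarith)
  have hs0 := abs_le.1 (abs_oddBumpDeriv_le_two (driftShift t x 0 + driftShift t x 2))
  have hs1 := abs_le.1 (abs_oddBumpDeriv_le_two (driftShift t x 1 - driftShift t x 2))
  have hs2 := abs_le.1 (abs_oddBumpDeriv_le_two (driftShift t x 1 + driftShift t x 2))
  have hA : |cellAmp t ^ 2 * (2 * oddBumpDeriv (driftShift t x 1 - driftShift t x 2) +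
      2 * oddBumpDeriv (driftShift t x 1 + driftShift t x 2))| ≤ 8 * (-t)⁻¹ := by
    rw [abs_mul, hsq, abs_of_pos hpos]
    have h : |2 * oddBumpDeriv (driftShift t x 1 - driftShift t x 2) +
        2 * oddBumpDeriv (driftShift t x 1 + driftShift t x 2)| ≤ 8 := by
      rw [abs_le]; constructor <;> linarith
    nlinarith
  have hB : |cellAmp t ^ 2 * (2 * oddBumpDeriv (driftShift t x 0 + driftShift t x 2))| ≤ 4 * (-t)⁻¹ := by
    rw [abs_mul, hsq, abs_of_pos hpos]
    have h : |2 * oddBumpDeriv (driftShift t x 0 + driftShift t x 2)| ≤ 4 := by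
      rw [abs_le]; constructor <;> linarith
    nlinarith
  rw [curl_sheetProfile]
  refine (norm_add_le _ _).trans ?_
  rw [norm_smul, norm_smul, e0, e1, mul_one, mul_one, Real.norm_eq_abs, Real.norm_eq_abs, div_eq_inv_mul]
  linarith

/-! ## The slice identities (R), (C), (D), (P), (F) -/

/-- (R) the Type-I time rate with constant `6`. [folklore] -/
theorem hasTypeITimeDecay_sheetProfile : HasTypeITimeDecay 6 sheetProfile := by
  intro t ht x
  show ‖cellAmp t • sheetField (driftShift t x)‖ ≤ 6 / Real.sqrt (-t)
  rw [norm_smul, Real.norm_of_nonneg (cellAmp_nonneg t), cellAmp, div_eq_inv_mul]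
  exact mul_le_mul_of_nonneg_left (norm_sheetField_le _) (inv_nonneg.2 (Real.sqrt_nonneg _))

/-- (C) continuity on the open backward slab. [folklore] -/
theorem continuousOn_sheetProfile :
    ContinuousOn (Function.uncurry sheetProfile) (Set.Iio (0 : ℝ) ×ˢ Set.univ) := by
  have hamp : ContinuousOn (fun z : ℝ × EuclideanSpace ℝ (Fin 3) => cellAmp z.1) (Set.Iio (0 : ℝ) ×ˢ Set.univ) := by
    refine ContinuousOn.inv₀ ?_ fun z hz => (Real.sqrt_pos.2 (neg_pos.2 (show z.1 < 0 from hz.1))).ne'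
    exact ((Real.continuous_sqrt.comp continuous_neg).comp continuous_fst).continuousOn
  have hlog : ContinuousOn (fun z : ℝ × EuclideanSpace ℝ (Fin 3) => Real.log (-z.1)) (Set.Iio (0 : ℝ) ×ˢ Set.univ) :=
    (continuous_neg.comp continuous_fst).continuousOn.log fun z hz => (neg_pos.2 (show z.1 < 0 from hz.1)).ne'
  have hshift : ContinuousOn (fun z : ℝ × EuclideanSpace ℝ (Fin 3) => driftShift z.1 z.2)
      (Set.Iio (0 : ℝ) ×ˢ Set.univ) :=
    (hamp.smul continuousOn_snd).add (hlog.smul continuousOn_const)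
  exact hamp.smul (continuous_sheetField.comp_continuousOn hshift)

/-- (D) divergence-free slices. [folklore] -/
theorem isDivFree_sheetProfile (t : ℝ) : VectorCalculus.IsDivFree (sheetProfile t) := by
  intro y
  rw [divergence_eq_sum_inner_fderiv (EuclideanSpace.basisFun (Fin 3) ℝ), Fin.sum_univ_three]
  simp only [EuclideanSpace.basisFun_apply, EuclideanSpace.inner_single_left, map_one, one_mul,
    fderiv_sheetProfile_apply]
  have h := sheetDeriv_trace (driftShift t y)
  calc cellAmp t ^ 2 * sheetDeriv (driftShift t y) (EuclideanSpace.single 0 1) 0 +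
        cellAmp t ^ 2 * sheetDeriv (driftShift t y) (EuclideanSpace.single 1 1) 1 +
        cellAmp t ^ 2 * sheetDeriv (driftShift t y) (EuclideanSpace.single 2 1) 2
      = cellAmp t ^ 2 * (sheetDeriv (driftShift t y) (EuclideanSpace.single 0 1) 0 +
          sheetDeriv (driftShift t y) (EuclideanSpace.single 1 1) 1 +
          sheetDeriv (driftShift t y) (EuclideanSpace.single 2 1) 2) := by ring
    _ = 0 := by rw [h, mul_zero]

/-- (P) poloidal along `e₂` everywhere on every slice. [folklore] -/
theorem poloidal_sheetProfile (s : ℝ) (y : EuclideanSpace ℝ (Fin 3)) :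
    ⟪curl (sheetProfile s) y, EuclideanSpace.single (2 : Fin 3) (1 : ℝ)⟫_ℝ = 0 := by
  rw [EuclideanSpace.inner_single_right, curl_sheetProfile_apply_two]
  simp

/-- (F) the frozen constraint `⟪Dv(s)(y) curl v(s)(y), e₂⟫ = 0`. [folklore] -/
theorem frozen_sheetProfile (s : ℝ) (y : EuclideanSpace ℝ (Fin 3)) :
    ⟪fderiv ℝ (sheetProfile s) y (curl (sheetProfile s) y), EuclideanSpace.single (2 : Fin 3) (1 : ℝ)⟫_ℝ = 0 := by
  rw [EuclideanSpace.inner_single_right, fderiv_sheetProfile_apply, sheetDeriv_apply_two, curl_sheetProfile_apply_zero,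
    curl_sheetProfile_apply_one, curl_sheetProfile_apply_two, RCLike.conj_to_real]
  ring

/-! ## The singularity at the apex -/

/-- On `[3/10, 1/2]` the bump is at least `1/6` (`(1+u²)⁵ ≤ (5/4)⁵ ≤ 18/5 ≤ 12u`). [folklore] -/
theorem oddBump_ge_sixth {u : ℝ} (h1 : 3 / 10 ≤ u) (h2 : u ≤ 1 / 2) : 1 / 6 ≤ oddBump u := by
  unfold oddBump
  have hp := (show (0:ℝ) < 1 + u ^ 2 by positivity)
  rw [le_div_iff₀ (pow_pos hp 5)]
  have hsq : 1 + u ^ 2 ≤ 5 / 4 := by nlinarith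
  have h5 : (1 + u ^ 2) ^ 5 ≤ (5 / 4 : ℝ) ^ 5 := pow_le_pow_left₀ hp.le hsq 5
  nlinarith

/-- **(S) the three-sheet profile is backward-singular at the apex**: for `t ∈ (−τ, −τ/2)` and `x` in the open set
`B(0, √τ) ∩ {3√τ/10 < x₀ + x₂ < 7√τ/20}` the similarity coordinate `u = (−t)^{-1/2}(x₀ + x₂)` lies in
`[3/10, 1/2]`, so `‖v(t, x)‖ ≥ |v₀(t,x)| = (−t)^{-1/2} β(u) ≥ (−t)^{-1/2}/6` (the drift acts on the coordinate `1`,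
which `v₀` does not see). [folklore] -/
theorem isBackwardSingularPoint_sheetProfile : IsBackwardSingularPoint sheetProfile 0 := by
  intro r hr
  rw [eLpNorm_exponent_top]
  show essSup (fun z => ‖uncurry sheetProfile z‖ₑ) _ = ⊤
  apply essSup_eq_top_of_forall_exists_lt
  intro N
  set K : ℝ := (N : ℝ) + 1 with hK
  have hKpos : 0 < K := by positivity
  set C : ℝ := 1 / 6 with hCdef
  have hC : 0 < C := by norm_num
  set τ : ℝ := min (r ^ 2) ((C / K) ^ 2) / 2 with hτ
  have hmin : 0 < min (r ^ 2) ((C / K) ^ 2) := lt_min (by positivity) (by positivity)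
  have hτpos : 0 < τ := by positivity
  have hτr : τ < r ^ 2 := by
    have := min_le_left (r ^ 2) ((C / K) ^ 2)
    rw [hτ]; linarith
  have hτK : τ < (C / K) ^ 2 := by
    have := min_le_right (r ^ 2) ((C / K) ^ 2)
    rw [hτ]; linarith
  set ρ : ℝ := Real.sqrt τ with hρ
  have hρpos : 0 < ρ := Real.sqrt_pos.2 hτpos
  have hρr : ρ < r := by
    rw [hρ, ← Real.sqrt_sq hr.le]
    exact Real.sqrt_lt_sqrt hτpos.le hτr
  set U : Set (EuclideanSpace ℝ (Fin 3)) :=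
    ball 0 ρ ∩ {x | 3 * ρ / 10 < x 0 + x 2 ∧ x 0 + x 2 < 7 * ρ / 20} with hU
  have hUopen : IsOpen U := by
    refine isOpen_ball.inter ?_
    have hc : Continuous fun x : EuclideanSpace ℝ (Fin 3) => x 0 + x 2 := by fun_prop
    exact (isOpen_lt continuous_const hc).inter (isOpen_lt hc continuous_const)
  have hUne : U.Nonempty := by
    refine ⟨(13 * ρ / 80) • EuclideanSpace.single (0 : Fin 3) (1 : ℝ) +
      (13 * ρ / 80) • EuclideanSpace.single (2 : Fin 3) (1 : ℝ), ?_, ?_⟩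
    · rw [mem_ball_zero_iff]
      refine lt_of_le_of_lt (norm_add_le _ _) ?_
      rw [norm_smul, norm_smul, Real.norm_of_nonneg (by positivity)]
      simp
      linarith
    · simp
      constructor <;> linarith
  refine ⟨Ioo (-τ) (-(τ / 2)) ×ˢ U, ?_, ?_⟩
  · have hsub : Ioo (-τ) (-(τ / 2)) ×ˢ U ⊆ parabolicCylinder r (0 : ℝ × EuclideanSpace ℝ (Fin 3)) := by
      rintro ⟨t, x⟩ ⟨⟨ht1, ht2⟩, hx⟩
      rw [mem_parabolicCylinder]
      refine ⟨⟨?_, ?_⟩, ?_⟩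
      · simp only [Prod.fst_zero]; linarith
      · simp only [Prod.fst_zero]; linarith
      · simp only [Prod.snd_zero]
        have h1 : x ∈ ball (0 : EuclideanSpace ℝ (Fin 3)) ρ := hx.1
        rw [mem_ball] at h1
        exact lt_trans h1 hρr
    rw [Measure.restrict_apply (measurableSet_Ioo.prod hUopen.measurableSet),
      inter_eq_left.2 hsub, Measure.volume_eq_prod, Measure.prod_prod]
    refine mul_ne_zero ?_ (hUopen.measure_pos volume hUne).ne'
    rw [Real.volume_Ioo, ne_eq, ENNReal.ofReal_eq_zero, not_le]
    linarith
  · rintro ⟨t, x⟩ ⟨⟨ht1, ht2⟩, hx⟩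
    simp only [uncurry_apply_pair]
    obtain ⟨hxb, hxl, hxu⟩ := hx
    have hnt : 0 < -t := by linarith
    have hspos : 0 < Real.sqrt (-t) := Real.sqrt_pos.2 hnt
    have hamp : cellAmp t = (Real.sqrt (-t))⁻¹ := rfl
    -- the similarity coordinate `u = c (x₀ + x₂)` lies in `[3/10, 1/2]`
    have hc1 : 1 ≤ cellAmp t * ρ := by
      -- `ρ = √τ ≥ √(−t)`
      have h1 : Real.sqrt (-t) ≤ ρ := by rw [hρ]; exact Real.sqrt_le_sqrt (by linarith)
      rw [hamp, le_inv_mul_iff₀ hspos, mul_one]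
      exact h1
    have hc2 : cellAmp t * ρ ≤ Real.sqrt 2 := by
      -- `ρ = √τ ≤ √2 √(−t)` since `τ ≤ 2(−t)`
      have h1 : ρ ≤ Real.sqrt 2 * Real.sqrt (-t) := by
        rw [hρ, ← Real.sqrt_mul (by norm_num : (0 : ℝ) ≤ 2)]
        exact Real.sqrt_le_sqrt (by linarith)
      rw [hamp, inv_mul_le_iff₀ hspos, mul_comm]
      exact h1
    have hsqrt2 : Real.sqrt 2 * 7 < 10 := by
      have h := Real.sqrt_lt_sqrt (by norm_num : (0 : ℝ) ≤ 2) (by norm_num : (2 : ℝ) < 100 / 49)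
      rw [show (100 / 49 : ℝ) = (10 / 7) ^ 2 by norm_num, Real.sqrt_sq (by norm_num)] at h
      linarith
    have hu1 : 3 / 10 ≤ driftShift t x 0 + driftShift t x 2 := by
      rw [driftShift_apply_zero, driftShift_apply_two, ← mul_add]
      have := mul_le_mul_of_nonneg_left hxl.le (cellAmp_nonneg t)
      nlinarith
    have hu2 : driftShift t x 0 + driftShift t x 2 ≤ 1 / 2 := by
      rw [driftShift_apply_zero, driftShift_apply_two, ← mul_add]
      have := mul_le_mul_of_nonneg_left hxu.le (cellAmp_nonneg t)
      nlinarith [cellAmp_nonneg t]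
    have hβ : 1 / 6 ≤ oddBump (driftShift t x 0 + driftShift t x 2) := oddBump_ge_sixth hu1 hu2
    -- lower bound on the first component
    have hlow : C / Real.sqrt (-t) ≤ ‖sheetProfile t x‖ := by
      have h0 : sheetProfile t x 0 = cellAmp t * oddBump (driftShift t x 0 + driftShift t x 2) := by
        simp only [sheetProfile, PiLp.smul_apply, smul_eq_mul, sheetField_apply_zero]
      calc C / Real.sqrt (-t) = cellAmp t * C := by rw [hamp, div_eq_inv_mul]
        _ ≤ cellAmp t * oddBump (driftShift t x 0 + driftShift t x 2) :=
            mul_le_mul_of_nonneg_left (by rw [hCdef]; exact hβ) (cellAmp_nonneg t)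
        _ = |sheetProfile t x 0| := by
            rw [h0, abs_of_nonneg (mul_nonneg (cellAmp_nonneg t) (by linarith))]
        _ = ‖sheetProfile t x 0‖ := (Real.norm_eq_abs _).symm
        _ ≤ ‖sheetProfile t x‖ := PiLp.norm_apply_le _ 0
    rw [← ofReal_norm, show ((N : ℝ≥0) : ℝ≥0∞) = ENNReal.ofReal (N : ℝ) by simp]
    rw [ENNReal.ofReal_lt_ofReal_iff (lt_of_lt_of_le (div_pos hC hspos) hlow)]
    refine lt_of_lt_of_le ?_ hlow
    rw [lt_div_iff₀ hspos]
    have hst : Real.sqrt (-t) < C / K := by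
      rw [Real.sqrt_lt' (div_pos hC hKpos)]
      linarith
    calc (N : ℝ) * Real.sqrt (-t) ≤ K * Real.sqrt (-t) :=
          mul_le_mul_of_nonneg_right (by rw [hK]; linarith) hspos.le
      _ < K * (C / K) := mul_lt_mul_of_pos_left hst hKpos
      _ = C := by field_simp

/-! ## Clause (vii): super-critical production near every vorticity record -/

/-- `(−s)²|curl v(s)(y)|² = |curl S(A_s y)|² ≤ 80` on every slice `s < 0`. [folklore] -/
theorem critEnstrophy_sheetProfile {s : ℝ} (hs : s < 0) (y : EuclideanSpace ℝ (Fin 3)) :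
    (-s) ^ 2 * ⟪curl (sheetProfile s) y, curl (sheetProfile s) y⟫_ℝ =
      (2 * oddBumpDeriv (driftShift s y 1 - driftShift s y 2) + 2 * oddBumpDeriv (driftShift s y 1 + driftShift s y 2)) ^ 2
        + (2 * oddBumpDeriv (driftShift s y 0 + driftShift s y 2)) ^ 2 := by
  have h1 : (-s) * cellAmp s ^ 2 = 1 := by rw [cellAmp_sq hs]; exact mul_inv_cancel₀ (by linarith)
  rw [Literature.Algebra.EuclideanLattices.inner_fin_three, curl_sheetProfile_apply_zero, curl_sheetProfile_apply_one,
    curl_sheetProfile_apply_two]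
  have : (-s) ^ 2 * (cellAmp s ^ 2) ^ 2 = 1 := by rw [← mul_pow, h1, one_pow]
  linear_combination ((2 * oddBumpDeriv (driftShift s y 1 - driftShift s y 2) +
    2 * oddBumpDeriv (driftShift s y 1 + driftShift s y 2)) ^ 2 +
    (2 * oddBumpDeriv (driftShift s y 0 + driftShift s y 2)) ^ 2) * this

/-- The record point `y⋆ = 0` of the slice `s = −1`: `curl S(0) = (8, 4, 0)`. [folklore] -/
theorem curl_sheetField_zero :
    curl sheetField 0 = (8 : ℝ) • EuclideanSpace.single (0 : Fin 3) (1 : ℝ) +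
      (4 : ℝ) • EuclideanSpace.single (1 : Fin 3) (1 : ℝ) := by
  rw [curl_sheetField]
  simp only [PiLp.zero_apply, add_zero, sub_zero, oddBumpDeriv_zero]
  norm_num

/-- **Clause (vii) of S2⁗ HOLDS for the three-sheet profile**: near (indeed above) every value of the critical
enstrophy `(−s)²|ω|²` there is a point of super-critical production — the record `(−1, 0)`, where
`|ω|² = 80 < 128 = (−s)⟪ω, Dv ω⟫`. [folklore] -/
theorem sheetProfile_nearPeakSupercritical :
    ∀ θ : ℝ, 0 ≤ θ → ∀ s₀ < 0, ∀ y₀ : EuclideanSpace ℝ (Fin 3),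
      θ < (-s₀) ^ 2 * ⟪curl (sheetProfile s₀) y₀, curl (sheetProfile s₀) y₀⟫_ℝ →
      ∃ s < 0, ∃ y : EuclideanSpace ℝ (Fin 3),
        θ < (-s) ^ 2 * ⟪curl (sheetProfile s) y, curl (sheetProfile s) y⟫_ℝ ∧
        ⟪curl (sheetProfile s) y, curl (sheetProfile s) y⟫_ℝ <
          (-s) * ⟪curl (sheetProfile s) y, fderiv ℝ (sheetProfile s) y (curl (sheetProfile s) y)⟫_ℝ := by
  intro θ _ s₀ hs₀ y₀ hθ
  have h80 : θ < 80 := by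
    rw [critEnstrophy_sheetProfile hs₀] at hθ
    exact lt_of_lt_of_le hθ (curl_sheetField_sq_le _)
  refine ⟨-1, by norm_num, 0, ?_, ?_⟩
  · rw [sheetProfile_neg_one, curl_sheetField_zero, Literature.Algebra.EuclideanLattices.inner_fin_three]
    simp
    linarith
  · rw [sheetProfile_neg_one, curl_sheetField_zero, fderiv_sheetField,
      Literature.Algebra.EuclideanLattices.inner_fin_three, Literature.Algebra.EuclideanLattices.inner_fin_three,
      sheetDeriv_apply_zero, sheetDeriv_apply_one, sheetDeriv_apply_two]
    have w0 : ((8 : ℝ) • EuclideanSpace.single (0 : Fin 3) (1 : ℝ) +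
        (4 : ℝ) • EuclideanSpace.single (1 : Fin 3) (1 : ℝ) : EuclideanSpace ℝ (Fin 3)) 0 = 8 := by simp
    have w1 : ((8 : ℝ) • EuclideanSpace.single (0 : Fin 3) (1 : ℝ) +
        (4 : ℝ) • EuclideanSpace.single (1 : Fin 3) (1 : ℝ) : EuclideanSpace ℝ (Fin 3)) 1 = 4 := by simp
    have w2 : ((8 : ℝ) • EuclideanSpace.single (0 : Fin 3) (1 : ℝ) +
        (4 : ℝ) • EuclideanSpace.single (1 : Fin 3) (1 : ℝ) : EuclideanSpace ℝ (Fin 3)) 2 = 0 := by simp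
    simp only [PiLp.zero_apply, w0, w1, w2, add_zero, sub_zero, oddBumpDeriv_zero]
    norm_num

end Summit.NavierStokesRegularity.NavierStokesRegularity.Theorems.PoloidalWindowRigidity.Negative

end
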